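import Summits.Ventures.PercRepro.SixFourTransfer
import Summits.Ventures.PercRepro.SixFourPLAssembly

/-!
# PercRepro — C-025 at `(6,4)`: conditional on the per-solid residue ONLY (p3, gen 10)

`rls_six_four_of_sixTwoSix : SixTwoSix → SixFourResidue → ∀ M, RLS M 6 4` (`SixFourTransfer.lean`) and
`sixTwoSix_holds : SixTwoSix` (`SixFourPLAssembly.lean`) give C-025 at `(6,4)` on every finite matroid with the
single remaining hypothesis `SixFourResidue` (the solids with at most `9` points or a plane trace of at least `8`
points, `SixFourTransfer.lean`): **`rls_six_four_of_residue`** and its set-builder spelling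
**`c025_six_four_of_residue`**.
-/

namespace PercRepro.SixFour

open Finset ThmH PerFlat ThmN

/-- **C-025 at `(6, 4)` on every finite matroid, conditional on the per-solid residue only**:
`SixFourResidue → RLS M 6 4`, i.e. `(6/5) · #{A ⊆ E : ρ(A) = 6, ρ(E ∖ A) = 4} ≤ #{A ⊆ E : ρ(A) = 5}`
(`rls_six_four_of_sixTwoSix` with `sixTwoSix_holds`). -/
theorem rls_six_four_of_residue {α : Type} (hres : SixFourResidue) (M : Matroid α) [M.Finite] : RLS M 6 4 :=
  rls_six_four_of_sixTwoSix sixTwoSix_holds hres M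

/-- **C-025 at `(6, 4)` in the set-builder spelling of `C025`, conditional on the per-solid residue only**:
`Φ(6, 4) · #{A ⊆ E : ρ(A) = 6, ρ(E ∖ A) = 4} ≤ #{A ⊆ E : 4 < ρ(A) < 6}` on every finite matroid. -/
theorem c025_six_four_of_residue {α : Type} (hres : SixFourResidue) (M : Matroid α) [M.Finite] :
    phiK 6 4 * ({A : Set α | A ⊆ M.E ∧ M.eRk A = ((6 : ℕ) : ℕ∞) ∧ M.eRk (M.E \ A) = ((4 : ℕ) : ℕ∞)}.ncard : ℚ) ≤
      ({A : Set α | A ⊆ M.E ∧ ((4 : ℕ) : ℕ∞) < M.eRk A ∧ M.eRk A < ((6 : ℕ) : ℕ∞)}.ncard : ℚ) :=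
  c025_six_four_of_sixTwoSix sixTwoSix_holds hres M

end PercRepro.SixFour
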